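import Summits.HubbardSuperconductivity.HubbardSuperconductivity.Theorems.TwSeededEnsembleEquivalence.Negative.ObstructionTemplates
import Literature.MathematicalPhysics.QuantumLattice.GibbsPressureTemperature
import Literature.MathematicalPhysics.QuantumLattice.HubbardGrandCanonicalDensity

/-!
# β-monotonicity (Template D) for crux `TwSeededEnsembleEquivalence` (stmt-HubbardSuperconductivity-1698)

Negative-side support lemmas (refuter, cdisprove gen 3), all sorry-free and definition-free:

* generic matrix facts: `log_partitionFn_chord` (chord of the convex `β ↦ log Z_β` between `0` and
  `β'`), `neg_mul_groundEnergy_le_log_partitionFn` / `log_partitionFn_le_log_card_sub`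
  (`−βE₀ ≤ log Z_β ≤ log dim − βE₀`), `log_card_fock` (`log dim Fock = L² log 4`),
  `abs_groundEnergy_sub_smul_totalNumber_le` (`μ ↦ E₀(K − μN̂)` is `2|Λ|`-Lipschitz, any lattice);
* TEMPLATE D: `seededGC_pressure_sub_allowance_mono` (`β ↦ log Re Z_β/(βL²) − log 4/β` is
  non-decreasing for the grand-canonical seeded torus Hamiltonian) and
  `twSeededEnsembleEquivalence_instance_anti_beta` (a crux instance at `β'` implies the instance at
  every `0 < β ≤ β'` with the SAME `μ, ε, L`: the `∀ β ≥ 1` of the crux is carried by `β → ∞`).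

Companion file `HullTouchNormalForm.lean` (Template C, the T = 0 normal form) imports this one.
See `Cruxes/TwSeededEnsembleEquivalence/Disproof.lean` (gen 3) for the analysis these serve.
-/

namespace Summit.HubbardSuperconductivity.HubbardSuperconductivity.Theorems.TwSeededEnsembleEquivalence.Negative

open Matrix Literature.MathematicalPhysics.QuantumLattice
open Summit.HubbardSuperconductivity.HubbardSuperconductivity.Theses.ThermalWedge
open scoped ComplexOrder
open Filter Topology

noncomputable section

/-! ### Generic matrix facts -/

/-- `Re Z_0(A) = dim`. [folklore] -/
theorem partitionFn_zero_re {m : Type*} [Fintype m] [DecidableEq m] (A : Matrix m m ℂ) :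
    (A.partitionFn 0).re = Fintype.card m := by
  simp [Matrix.partitionFn, Matrix.trace_one]

/-- **Chord inequality for `β ↦ log Z_β`** between `0` and `β'`, read at `β ∈ (0, β']`:
`β' log Z_β ≤ (β' − β) log dim + β log Z_{β'}` (convexity of `log Z` in `β`, from the tree's
supporting-line form `log_partitionFn_sub_mul_energy_le`). [folklore] -/
theorem log_partitionFn_chord {m : Type*} [Fintype m] [DecidableEq m] [Nonempty m]
    {A : Matrix m m ℂ} (hA : A.IsHermitian) {β β' : ℝ} (hβ : 0 < β) (hle : β ≤ β') :
    β' * Real.log (A.partitionFn β).re ≤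
      (β' - β) * Real.log (Fintype.card m) + β * Real.log (A.partitionFn β').re := by
  have h0 := log_partitionFn_sub_mul_energy_le hA 0 hβ
  have h1 := log_partitionFn_sub_mul_energy_le hA β' hβ
  rw [partitionFn_zero_re] at h0
  have h0' := mul_le_mul_of_nonneg_left h0 (sub_nonneg.2 hle)
  have h1' := mul_le_mul_of_nonneg_left h1 hβ.le
  nlinarith [h0', h1']

/-- `−β E₀ ≤ log Re Z_β`. [folklore] -/
theorem neg_mul_groundEnergy_le_log_partitionFn {m : Type*} [Fintype m] [DecidableEq m] [Nonempty m]
    {A : Matrix m m ℂ} (hA : A.IsHermitian) (β : ℝ) :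
    -(β * A.groundEnergy) ≤ Real.log (A.partitionFn β).re := by
  have h1 := exp_neg_mul_groundEnergy_le_partitionFn hA β
  calc -(β * A.groundEnergy) = Real.log (Real.exp (-(β * A.groundEnergy))) := (Real.log_exp _).symm
    _ ≤ Real.log (A.partitionFn β).re := Real.log_le_log (Real.exp_pos _) h1

/-- `log Re Z_β ≤ log dim − β E₀` for `β ≥ 0`. [folklore] -/
theorem log_partitionFn_le_log_card_sub {m : Type*} [Fintype m] [DecidableEq m] [Nonempty m]
    {A : Matrix m m ℂ} (hA : A.IsHermitian) {β : ℝ} (hβ : 0 ≤ β) :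
    Real.log (A.partitionFn β).re ≤ Real.log (Fintype.card m) - β * A.groundEnergy := by
  have h1 := partitionFn_le_card_mul_exp hA hβ
  have h0 : 0 < (A.partitionFn β).re :=
    lt_of_lt_of_le (Real.exp_pos _) (exp_neg_mul_groundEnergy_le_partitionFn hA β)
  have hc : (0 : ℝ) < Fintype.card m := by exact_mod_cast Fintype.card_pos
  calc Real.log (A.partitionFn β).re
      ≤ Real.log (Fintype.card m * Real.exp (-(β * A.groundEnergy))) := Real.log_le_log h0 h1
    _ = Real.log (Fintype.card m) - β * A.groundEnergy := by
        rw [Real.log_mul hc.ne' (Real.exp_pos _).ne', Real.log_exp]; ring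

/-- `log dim Fock = L² log 4` for the torus of side `L` (`dim = 2^{2L²}`). [folklore] -/
theorem log_card_fock (L : ℕ) [NeZero L] :
    Real.log (Fintype.card (Finset (Orb (FermionTorus 2 L))) : ℝ) = (L : ℝ) ^ 2 * Real.log 4 := by
  rw [Fintype.card_finset, card_orb, card_fermionTorus]
  push_cast
  rw [Real.log_pow, show (4 : ℝ) = 2 ^ 2 by norm_num, Real.log_pow]
  push_cast
  ring

section Generic

variable {Λ : Type*} [LinearOrder Λ] [Fintype Λ]

/-- `0 ≤ Re ω_A(N̂) ≤ 2|Λ|` for the tracial ground state of any Hermitian `A` (generic lattice;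
`0 ≤ N̂ ≤ 2|Λ|` from the tree). [folklore] -/
theorem re_groundStateFunctional_totalNumber_mem_Icc
    {A : Matrix (Finset (Orb Λ)) (Finset (Orb Λ)) ℂ} (hA : A.IsHermitian) :
    (A.groundStateFunctional totalNumber).re ∈ Set.Icc (0 : ℝ) (2 * Fintype.card Λ) := by
  constructor
  · have h := groundStateFunctional_nonneg_of_posSemidef A (posSemidef_totalNumber (Λ := Λ))
    exact (Complex.nonneg_iff.mp h).1
  · have h := groundStateFunctional_nonneg_of_posSemidef A
      (posSemidef_two_mul_card_sub_totalNumber (Λ := Λ))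
    rw [map_sub, map_smul, groundStateFunctional_one hA] at h
    obtain ⟨hre, -⟩ := Complex.nonneg_iff.mp h
    simp only [Complex.sub_re, smul_eq_mul, mul_one, Complex.natCast_re] at hre
    have : (((2 * Fintype.card Λ : ℕ) : ℝ)) = 2 * Fintype.card Λ := by push_cast; ring
    linarith

/-- **`μ ↦ E₀(K − μN̂)` is `2|Λ|`-Lipschitz** for Hermitian `K` (Hellmann–Feynman supergradient
inequality of the tree, `sub_mul_re_groundStateFunctional_le`, and `0 ≤ N̂ ≤ 2|Λ|`). [folklore] -/
theorem abs_groundEnergy_sub_smul_totalNumber_le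
    {K : Matrix (Finset (Orb Λ)) (Finset (Orb Λ)) ℂ} (hK : K.IsHermitian) (μ μ' : ℝ) :
    |(K - (μ : ℂ) • totalNumber).groundEnergy - (K - (μ' : ℂ) • totalNumber).groundEnergy| ≤
      2 * Fintype.card Λ * |μ - μ'| := by
  have hO : (totalNumber : Matrix (Finset (Orb Λ)) _ ℂ).IsHermitian := totalNumber_isHermitian
  have h1 := sub_mul_re_groundStateFunctional_le hK hO μ μ'
  have h2 := sub_mul_re_groundStateFunctional_le hK hO μ' μ
  obtain ⟨hn0, hn2⟩ := re_groundStateFunctional_totalNumber_mem_Icc (isHermitian_sub_real_smul hK hO μ)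
  obtain ⟨hn0', hn2'⟩ :=
    re_groundStateFunctional_totalNumber_mem_Icc (isHermitian_sub_real_smul hK hO μ')
  set n := ((K - (μ : ℂ) • totalNumber).groundStateFunctional totalNumber).re
  set n' := ((K - (μ' : ℂ) • totalNumber).groundStateFunctional totalNumber).re
  have hc : (0 : ℝ) ≤ 2 * Fintype.card Λ := by positivity
  rw [abs_le]
  constructor
  · have : (μ - μ') * n ≤ 2 * Fintype.card Λ * |μ - μ'| := by
      calc (μ - μ') * n ≤ |μ - μ'| * n := mul_le_mul_of_nonneg_right (le_abs_self _) hn0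
        _ ≤ |μ - μ'| * (2 * Fintype.card Λ) := mul_le_mul_of_nonneg_left hn2 (abs_nonneg _)
        _ = 2 * Fintype.card Λ * |μ - μ'| := by ring
    nlinarith
  · have : (μ' - μ) * n' ≤ 2 * Fintype.card Λ * |μ - μ'| := by
      calc (μ' - μ) * n' ≤ |μ' - μ| * n' := mul_le_mul_of_nonneg_right (le_abs_self _) hn0'
        _ ≤ |μ' - μ| * (2 * Fintype.card Λ) := mul_le_mul_of_nonneg_left hn2' (abs_nonneg _)
        _ = 2 * Fintype.card Λ * |μ - μ'| := by rw [abs_sub_comm]; ring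
    nlinarith

end Generic

/-! ### The seeded Hamiltonians on the torus -/

/-- The canonical seeded Hamiltonian `hubbardTorus 2 L 1 U − (g/L²) ΔᴴΔ` is Hermitian. -/
theorem isHermitian_seededCan (L : ℕ) [NeZero L] (U g : ℝ) :
    (hubbardTorus 2 L 1 U - ((g / (L : ℝ) ^ 2 : ℝ) : ℂ) •
      ((pairField dWaveFormFactor L)ᴴ * pairField dWaveFormFactor L)).IsHermitian := by
  have h : (hubbardTorus 2 L 1 U).IsHermitian := by
    rw [← hubbardTorusWith_zero]; exact isHermitian_hubbardTorusWith L 1 U 0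
  exact h.sub (isHermitian_smul_seed L _)

/-- `H_gc(μ) = H_can − μ N̂` for the seeded Hamiltonians. -/
theorem seededGC_eq (L : ℕ) [NeZero L] (U μ g : ℝ) :
    hubbardTorusWith 2 L 1 U μ - ((g / (L : ℝ) ^ 2 : ℝ) : ℂ) •
        ((pairField dWaveFormFactor L)ᴴ * pairField dWaveFormFactor L) =
      (hubbardTorus 2 L 1 U - ((g / (L : ℝ) ^ 2 : ℝ) : ℂ) •
        ((pairField dWaveFormFactor L)ᴴ * pairField dWaveFormFactor L)) - (μ : ℂ) • totalNumber := by
  rw [hubbardTorusWith_eq]; abel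

/-- **`μ ↦ E₀(H_can − μN̂)` is `2L²`-Lipschitz** for the seeded torus Hamiltonian. -/
theorem abs_groundEnergy_seededGC_sub_le (L : ℕ) [NeZero L] (U g μ μ' : ℝ) :
    |(hubbardTorusWith 2 L 1 U μ - ((g / (L : ℝ) ^ 2 : ℝ) : ℂ) •
          ((pairField dWaveFormFactor L)ᴴ * pairField dWaveFormFactor L)).groundEnergy -
        (hubbardTorusWith 2 L 1 U μ' - ((g / (L : ℝ) ^ 2 : ℝ) : ℂ) •
          ((pairField dWaveFormFactor L)ᴴ * pairField dWaveFormFactor L)).groundEnergy| ≤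
      2 * (L : ℝ) ^ 2 * |μ - μ'| := by
  have h := abs_groundEnergy_sub_smul_totalNumber_le (isHermitian_seededCan L U g) μ μ'
  rw [card_fermionTorus, Nat.cast_pow] at h
  rw [seededGC_eq, seededGC_eq]
  convert h

/-! ### Template D — β-monotonicity of the defect functional -/

/-- **Template D (β-monotonicity).** For the grand-canonical seeded Hamiltonian at fixed `μ`, `L`:
`β ↦ log Re Z_β/(β L²) − log 4/β` is non-decreasing on `(0, ∞)` (chord of the convex
`β ↦ log Z_β` between `β = 0`, where `log Z_0 = L² log 4` exactly, and `β'`). Hence the crux's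
defect functional `e_L + p_L(β, μ) − μ n_L − log 4/β` is non-decreasing in `β`. [folklore] -/
theorem seededGC_pressure_sub_allowance_mono (L : ℕ) [NeZero L] (U μ g : ℝ) {β β' : ℝ}
    (hβ : 0 < β) (hle : β ≤ β') :
    Real.log ((hubbardTorusWith 2 L 1 U μ - ((g / (L : ℝ) ^ 2 : ℝ) : ℂ) •
          ((pairField dWaveFormFactor L)ᴴ * pairField dWaveFormFactor L)).partitionFn β).re /
          (β * (L : ℝ) ^ 2) - Real.log 4 / β ≤
      Real.log ((hubbardTorusWith 2 L 1 U μ - ((g / (L : ℝ) ^ 2 : ℝ) : ℂ) •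
          ((pairField dWaveFormFactor L)ᴴ * pairField dWaveFormFactor L)).partitionFn β').re /
          (β' * (L : ℝ) ^ 2) - Real.log 4 / β' := by
  have hβ' : 0 < β' := lt_of_lt_of_le hβ hle
  have hL : (0 : ℝ) < (L : ℝ) ^ 2 := cast_sq_pos_of_neZero L
  have hL0 : (L : ℝ) ≠ 0 := by
    intro h0; rw [h0] at hL; simp at hL
  have chord := log_partitionFn_chord (isHermitian_seededGC L U μ g) hβ hle
  rw [log_card_fock] at chord
  set Zβ := Real.log ((hubbardTorusWith 2 L 1 U μ - ((g / (L : ℝ) ^ 2 : ℝ) : ℂ) •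
          ((pairField dWaveFormFactor L)ᴴ * pairField dWaveFormFactor L)).partitionFn β).re
  set Zβ' := Real.log ((hubbardTorusWith 2 L 1 U μ - ((g / (L : ℝ) ^ 2 : ℝ) : ℂ) •
          ((pairField dWaveFormFactor L)ᴴ * pairField dWaveFormFactor L)).partitionFn β').re
  have hnum : 0 ≤ (β' - β) * ((L : ℝ) ^ 2 * Real.log 4) + β * Zβ' - β' * Zβ := by linarith
  have key : Zβ' / (β' * (L : ℝ) ^ 2) - Real.log 4 / β' - (Zβ / (β * (L : ℝ) ^ 2) - Real.log 4 / β) =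
      ((β' - β) * ((L : ℝ) ^ 2 * Real.log 4) + β * Zβ' - β' * Zβ) / (β * β' * (L : ℝ) ^ 2) := by
    field_simp
    ring
  have hpos : 0 < β * β' * (L : ℝ) ^ 2 := by positivity
  have := div_nonneg hnum hpos.le
  linarith [key]

/-- **Downward closure of crux instances in `β`.** If the crux inequality holds at
`(β', μ, ε, L)` then it holds at `(β, μ, ε, L)` for every `0 < β ≤ β'` (`A` = the sector energy
density term, `ν` = `μ n_L`; both are `β`-independent). -/
theorem twSeededEnsembleEquivalence_instance_anti_beta (L : ℕ) [NeZero L] (U μ g A ν : ℝ)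
    {β β' ε : ℝ} (hβ : 0 < β) (hle : β ≤ β')
    (h : A + Real.log ((hubbardTorusWith 2 L 1 U μ - ((g / (L : ℝ) ^ 2 : ℝ) : ℂ) •
          ((pairField dWaveFormFactor L)ᴴ * pairField dWaveFormFactor L)).partitionFn β').re /
          (β' * (L : ℝ) ^ 2) - ν ≤ Real.log 4 / β' + ε) :
    A + Real.log ((hubbardTorusWith 2 L 1 U μ - ((g / (L : ℝ) ^ 2 : ℝ) : ℂ) •
          ((pairField dWaveFormFactor L)ᴴ * pairField dWaveFormFactor L)).partitionFn β).re /
          (β * (L : ℝ) ^ 2) - ν ≤ Real.log 4 / β + ε := by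
  have := seededGC_pressure_sub_allowance_mono L U μ g hβ hle
  linarith

end

end Summit.HubbardSuperconductivity.HubbardSuperconductivity.Theorems.TwSeededEnsembleEquivalence.Negative
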